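import Summits.ABC.ABC.Theorems.TwistAmplificationMazurKaneLawSqrtLatticeToolX
import Summits.ABC.ABC.Theorems.TwistAmplificationMazurKaneLawToolkitTame

-- Summit.ABC.ABC is the mandated summit-side namespace (single-conjunct summit); the lakefile sets the same option tree-wide.
set_option linter.dupNamespace false

/-!
# The two-root tool with host the `x`-term, as a law (crux stmt-ABC-2757, stub `stub_twoRootTameX`)

Stub 3a (`stub_twoRootTameX`) of the line `critical-kloosterman-powerful-moduli` for the crux
`Summit.ABC.ABC.Theses.TwistAmplification.MazurKaneLaw`. For `η > 0` there is `K` (depending on `η` and the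
dimension `M` only) such that every admissible shape datum `(C₀; c₁, c₂, c₃; X, Y, Z)` (`AbcShapes.Admissible l ε`)
carrying the R₂ certificate with host `X` —
`P ≤ 2R · X₀Y₁Z₁` and `P ≤ R · (c₁ · shapeVal X)`, where `P = ∏ᵢ XᵢYᵢZᵢ`, `R = C₀^{l-1+3ε}`, `i₀ = 0` is the
linear coordinate and `i₁ = 1` the square coordinate — has `B_M = AbcShapes.shapeCount c₁ c₂ c₃ X Y Z ≤ K · C₀^{l-1+3ε+η}`.

Proof (`twoRootTameX_law`, general dimension `M`; the stub is the instance `M = numShapes ε`):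

* the landed square-root lattice tool `Summit.ABC.ABC.Theorems.MazurKaneLaw.sqrtLatticeToolX` with host set
  `H = {i₀}` and freed coordinate `i = i₁` gives
  `B ≤ F · Dτ^{M+3} · (2 + 112 · Y₁Z₁/(c₁ offVal_{i₀} X))`, `F = #subBox_{i₀} X · #subBox_{i₁} Y · #subBox_{i₁} Z`;
* `F · X₀Y₁Z₁ = P` (`AbcShapes.card_subBox_mul`) and `(c₁ offVal_{i₀} X) · X₀ = c₁ shapeVal X`
  (`AbcShapes.shapeVal_eq_offVal_mul_onVal`, `onVal {i₀} X = X₀`), so the two certificate inequalities bound the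
  bracket: `F · (2 + 112 Y₁Z₁/(c₁ offVal X)) = 2P/(X₀Y₁Z₁) + 112 P/(c₁ shapeVal X) ≤ 4R + 112R`;
* the endgame constants are those of `toolkitTame`: `T = V₂ · 2C₀` (`V₂ = shapeVal (2,…,2)`) bounds every
  `cⱼ · shapeVal (2·)`, `Dτ = ⌊C_τ T^κ⌋` with `κ (M+3) = η` (`Sieve.exists_card_divisors_le_mul_rpow`), so
  `Dτ^{M+3} ≤ C_τ^{M+3} (2V₂)^η C₀^η` and `K = 116 · C_τ^{M+3} · (2V₂)^η`.
-/

noncomputable section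

open Finset
open Literature.NumberTheory.DiophantineGeometry
open Literature.NumberTheory.DiophantineGeometry.AbcShapes

namespace Summit.ABC.ABC.Theorems.MazurKaneLaw

open Summit.ABC.ABC.Theorems.MazurKaneLaw.Toolkit

/-- **The two-root tool with host `x`, as a law, in a general dimension `M`.** For `η > 0` there is `K ≥ 0`
such that every `Admissible l ε` datum with `P ≤ 2R · X_{i₀}Y_{i₁}Z_{i₁}` and `P ≤ R · (c₁ shapeVal X)`
(`P = ∏ XᵢYᵢZᵢ`, `R = C₀^{l-1+3ε}`, `i₀ = 0`, `i₁ = 1`) has `B_M ≤ K · C₀^{l-1+3ε+η}`: the square-root lattice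
tool `sqrtLatticeToolX` at `H = {i₀}`, `i = i₁` gives `B ≤ F · Dτ^{M+3} · (2 + 112 Y₁Z₁/(c₁ offVal_{i₀} X))` with
`F · X₀Y₁Z₁ = P` and `(c₁ offVal_{i₀} X) · X₀ = c₁ shapeVal X`, so the bracket is `≤ 116 R · Dτ^{M+3}`, and
`Dτ = ⌊C_τ (2V₂C₀)^κ⌋`, `κ (M+3) = η`, gives `K = 116 C_τ^{M+3} (2V₂)^η`. [folklore] -/
theorem twoRootTameX_law (l ε : ℝ) {η : ℝ} (hη : 0 < η) (M : ℕ) :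
    ∃ K : ℝ, 0 ≤ K ∧ ∀ (C₀ c₁ c₂ c₃ : ℕ) (X Y Z : Fin M → ℕ) (i₀ i₁ : Fin M),
      (i₀ : ℕ) = 0 → (i₁ : ℕ) = 1 → Admissible l ε C₀ c₁ c₂ c₃ X Y Z →
        ((∏ i, ((X i : ℝ) * Y i * Z i)) ≤ 2 * (C₀ : ℝ) ^ (l - 1 + 3 * ε) * ((X i₀ : ℝ) * Y i₁ * Z i₁) ∧
          (∏ i, ((X i : ℝ) * Y i * Z i)) ≤ (C₀ : ℝ) ^ (l - 1 + 3 * ε) * ((c₁ * shapeVal X : ℕ) : ℝ)) →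
        (shapeCount c₁ c₂ c₃ X Y Z : ℝ) ≤ K * (C₀ : ℝ) ^ (l - 1 + 3 * ε + η) := by
  classical
  -- the constants `V₂`, `a = M + 3`, `κ = η / a`, `C_τ`, `K = 116 C_τ^a (2V₂)^η`
  obtain ⟨V2, hV2⟩ : ∃ V : ℕ, V = shapeVal (fun _ : Fin M => 2) := ⟨_, rfl⟩
  have hV2pos : 0 < V2 := by rw [hV2]; exact shapeVal_pos fun _ => two_pos
  have hV2r : (0 : ℝ) < V2 := by exact_mod_cast hV2pos
  obtain ⟨a, ha⟩ : ∃ a : ℝ, a = (M : ℝ) + 3 := ⟨_, rfl⟩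
  have ha0 : 0 < a := by rw [ha]; positivity
  obtain ⟨κ, hκ⟩ : ∃ κ : ℝ, κ = η / a := ⟨_, rfl⟩
  have hκ0 : 0 < κ := by rw [hκ]; positivity
  have hκa : κ * a = η := by rw [hκ]; field_simp
  obtain ⟨Cτ, hCτ1, hCτ⟩ := Literature.NumberTheory.Sieve.exists_card_divisors_le_mul_rpow hκ0
  have hCτ0 : 0 < Cτ := by linarith
  obtain ⟨K, hK⟩ : ∃ K : ℝ, K = 116 * (Cτ ^ a * ((2 : ℝ) * V2) ^ η) := ⟨_, rfl⟩
  have hK0 : 0 ≤ K := by rw [hK]; positivity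
  refine ⟨K, hK0, fun C₀ c₁ c₂ c₃ X Y Z i₀ i₁ hi₀ hi₁ hA hcert => ?_⟩
  obtain ⟨h1, h2⟩ := hcert
  obtain ⟨hC₀1, hc₁, hc₂, hc₃, -, -, -, hXp, hYp, hZp, -, hvX, hvY, hvZ, -⟩ := hA
  have hC₀ : (1 : ℝ) ≤ C₀ := by exact_mod_cast hC₀1
  have hC₀0 : (0 : ℝ) < C₀ := by linarith
  rcases Nat.eq_zero_or_pos (shapeCount c₁ c₂ c₃ X Y Z) with hB0 | hBpos
  · rw [hB0, Nat.cast_zero]; positivity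
  -- `T = V₂ · 2C₀`, `Dτ = ⌊C_τ T^κ⌋`
  obtain ⟨T, hT⟩ : ∃ T : ℕ, T = V2 * (2 * C₀) := ⟨_, rfl⟩
  have hT' : (T : ℝ) = 2 * V2 * C₀ := by rw [hT]; push_cast; ring
  have hTval : ∀ {c : ℕ} {W : Fin M → ℕ}, c * shapeVal W ≤ 2 * C₀ →
      c * shapeVal (fun i => 2 * W i) ≤ T := by
    intro c W hW
    calc c * shapeVal (fun i => 2 * W i) = V2 * (c * shapeVal W) := by
          rw [show (fun i => 2 * W i) = fun i => (fun _ : Fin M => 2) i * W i from rfl,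
            shapeVal_mul, ← hV2]; ring
      _ ≤ V2 * (2 * C₀) := Nat.mul_le_mul_left _ hW
      _ = T := hT.symm
  obtain ⟨Dτ, hDτ⟩ : ∃ D : ℕ, D = ⌊Cτ * (T : ℝ) ^ κ⌋₊ := ⟨_, rfl⟩
  have hD : ∀ n : ℕ, n ≠ 0 → n ≤ T → n.divisors.card ≤ Dτ := by
    intro n hn hnT
    rw [hDτ]
    refine Nat.le_floor ((hCτ n hn).trans ?_)
    exact mul_le_mul_of_nonneg_left (Real.rpow_le_rpow (Nat.cast_nonneg _)
      (by exact_mod_cast hnT) hκ0.le) hCτ0.le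
  have hDreal : (Dτ : ℝ) ≤ Cτ * (T : ℝ) ^ κ := by rw [hDτ]; exact Nat.floor_le (by positivity)
  -- the square-root lattice tool at `H = {i₀}`, `i = i₁`
  have hi₁1 : 1 ≤ (i₁ : ℕ) := by omega
  have htool := sqrtLatticeToolX hc₁ hc₂ hc₃ X Y Z hXp hYp hZp (hTval hvX) (hTval hvY) (hTval hvZ) hD
    ({i₀} : Finset (Fin M)) i₁ hi₁1
  -- name the fibre count `F`, the host cofactor `A`, and `P`, `R`
  obtain ⟨F, hF⟩ : ∃ F : ℕ, F = (subBox ({i₀} : Finset (Fin M)) X).card *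
      (subBox ({i₁} : Finset (Fin M)) Y).card * (subBox ({i₁} : Finset (Fin M)) Z).card := ⟨_, rfl⟩
  obtain ⟨A, hAdef⟩ : ∃ A : ℕ, A = c₁ * offVal ({i₀} : Finset (Fin M)) X := ⟨_, rfl⟩
  have hn : M + ((i₁ : ℕ) + 2) = M + 3 := by omega
  rw [← hF, ← hAdef, hn] at htool
  obtain ⟨P, hP⟩ : ∃ P : ℝ, P = ∏ i, ((X i : ℝ) * Y i * Z i) := ⟨_, rfl⟩
  obtain ⟨R, hR⟩ : ∃ R : ℝ, R = (C₀ : ℝ) ^ (l - 1 + 3 * ε) := ⟨_, rfl⟩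
  rw [← hP, ← hR] at h1 h2
  have hR0 : 0 < R := by rw [hR]; exact Real.rpow_pos_of_pos hC₀0 _
  have hX0 : (0 : ℝ) < X i₀ := by exact_mod_cast hXp i₀
  have hY1 : (0 : ℝ) < Y i₁ := by exact_mod_cast hYp i₁
  have hZ1 : (0 : ℝ) < Z i₁ := by exact_mod_cast hZp i₁
  have hXYZ : (0 : ℝ) < (X i₀ : ℝ) * Y i₁ * Z i₁ := by positivity
  have hA0 : (0 : ℝ) < A := by
    rw [hAdef]; exact_mod_cast Nat.mul_pos hc₁ (prod_pos fun j _ => pow_pos (hXp j) _)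
  -- `#subBox_{j} W · W_j = ∏ W` and `F · X₀Y₁Z₁ = P`
  have hsb : ∀ (W : Fin M → ℕ) (j : Fin M), (subBox ({j} : Finset (Fin M)) W).card * W j = ∏ i, W i := by
    intro W j
    have h := card_subBox_mul ({j} : Finset (Fin M)) W
    rwa [prod_singleton, card_dyadicBox] at h
  have hPF : (F : ℝ) * ((X i₀ : ℝ) * Y i₁ * Z i₁) = P := by
    have e : (F : ℝ) * ((X i₀ : ℝ) * Y i₁ * Z i₁) =
        (((subBox ({i₀} : Finset (Fin M)) X).card * X i₀ : ℕ) : ℝ) *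
          (((subBox ({i₁} : Finset (Fin M)) Y).card * Y i₁ : ℕ) : ℝ) *
          (((subBox ({i₁} : Finset (Fin M)) Z).card * Z i₁ : ℕ) : ℝ) := by
      rw [hF]; push_cast; ring
    rw [e, hsb X i₀, hsb Y i₁, hsb Z i₁, hP, prod_mul_distrib, prod_mul_distrib]
    push_cast
    ring
  -- `(c₁ offVal_{i₀} X) · X₀ = c₁ shapeVal X` (the exponent at the linear coordinate is `1`)
  have hAX : A * X i₀ = c₁ * shapeVal X := by
    rw [hAdef, shapeVal_eq_offVal_mul_onVal ({i₀} : Finset (Fin M)) X, onVal, prod_singleton, hi₀,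
      zero_add, pow_one, mul_assoc]
  have hV : (A : ℝ) * X i₀ = ((c₁ * shapeVal X : ℕ) : ℝ) := by exact_mod_cast hAX
  -- the two branches of the bracket
  have hF2 : (F : ℝ) ≤ 2 * R := le_of_mul_le_mul_right (by rw [hPF]; exact h1) hXYZ
  have hterm2 : (F : ℝ) * (112 * ((Y i₁ : ℝ) * Z i₁) / A) ≤ 112 * R := by
    rw [mul_div_assoc', div_le_iff₀ hA0]
    refine le_of_mul_le_mul_right ?_ hX0
    calc (F : ℝ) * (112 * ((Y i₁ : ℝ) * Z i₁)) * X i₀ = 112 * ((F : ℝ) * ((X i₀ : ℝ) * Y i₁ * Z i₁)) := by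
          ring
      _ = 112 * P := by rw [hPF]
      _ ≤ 112 * (R * ((c₁ * shapeVal X : ℕ) : ℝ)) := by linarith
      _ = 112 * R * A * X i₀ := by rw [← hV]; ring
  have hbr : (F : ℝ) * (2 + 112 * ((Y i₁ : ℝ) * Z i₁) / A) ≤ 116 * R := by
    rw [mul_add]; linarith
  -- `Dτ^{M+3} ≤ C_τ^a (2V₂)^η C₀^η`
  have hDpow : (Dτ : ℝ) ^ (M + 3) = (Dτ : ℝ) ^ a := by
    rw [ha]; exact_mod_cast (Real.rpow_natCast (Dτ : ℝ) (M + 3)).symm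
  have hDa : (Dτ : ℝ) ^ a ≤ Cτ ^ a * ((2 : ℝ) * V2) ^ η * (C₀ : ℝ) ^ η := by
    calc (Dτ : ℝ) ^ a ≤ (Cτ * (T : ℝ) ^ κ) ^ a := Real.rpow_le_rpow (Nat.cast_nonneg _) hDreal ha0.le
      _ = Cτ ^ a * (T : ℝ) ^ η := by
          rw [Real.mul_rpow hCτ0.le (by positivity), ← Real.rpow_mul (Nat.cast_nonneg _), hκa]
      _ = Cτ ^ a * ((2 : ℝ) * V2) ^ η * (C₀ : ℝ) ^ η := by
          rw [hT', Real.mul_rpow (by positivity) hC₀0.le, mul_assoc]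
  calc (shapeCount c₁ c₂ c₃ X Y Z : ℝ)
        ≤ (F : ℝ) * (Dτ : ℝ) ^ (M + 3) * (2 + 112 * ((Y i₁ : ℝ) * Z i₁) / A) := htool
    _ = (Dτ : ℝ) ^ a * ((F : ℝ) * (2 + 112 * ((Y i₁ : ℝ) * Z i₁) / A)) := by rw [hDpow]; ring
    _ ≤ (Cτ ^ a * ((2 : ℝ) * V2) ^ η * (C₀ : ℝ) ^ η) * (116 * R) :=
        mul_le_mul hDa hbr (by positivity) (by positivity)
    _ = K * (R * (C₀ : ℝ) ^ η) := by rw [hK]; ring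
    _ = K * (C₀ : ℝ) ^ (l - 1 + 3 * ε + η) := by rw [hR, ← Real.rpow_add hC₀0]

/-- **STUB 3a · `stub_twoRootTameX`** of the line `critical-kloosterman-powerful-moduli` (crux stmt-ABC-2757): the
two-root tool with host the `x`-term, as a law — for `1 < l < 2`, `0 < ε < 1/2`, `η > 0` there is `K` with
`B_M ≤ K · C₀^{l-1+3ε+η}` on every `Admissible l ε` datum carrying the R₂ certificate with host `X`
(`P ≤ 2R · X₀Y₁Z₁ ∧ P ≤ R · (c₁ shapeVal X)`, `P = ∏ XᵢYᵢZᵢ`, `R = C₀^{l-1+3ε}`). This is `twoRootTameX_law`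
at `M = numShapes ε`, with the registered (fully explicit) signature. [folklore] -/
theorem stub_twoRootTameX : ∀ l : ℝ, 1 < l → l < 2 → ∀ ε : ℝ, 0 < ε → ε < 1 / 2 → ∀ η : ℝ, 0 < η → ∃ K : ℝ, ∀ (C₀ c₁ c₂ c₃ : ℕ) (X Y Z : Fin (Literature.NumberTheory.DiophantineGeometry.AbcShapes.numShapes ε) → ℕ) (i₀ i₁ : Fin (Literature.NumberTheory.DiophantineGeometry.AbcShapes.numShapes ε)), (i₀ : ℕ) = 0 → (i₁ : ℕ) = 1 → Literature.NumberTheory.DiophantineGeometry.AbcShapes.Admissible l ε C₀ c₁ c₂ c₃ X Y Z → ((∏ i, ((X i : ℝ) * Y i * Z i)) ≤ 2 * (C₀ : ℝ) ^ (l - 1 + 3 * ε) * ((X i₀ : ℝ) * Y i₁ * Z i₁) ∧ (∏ i, ((X i : ℝ) * Y i * Z i)) ≤ (C₀ : ℝ) ^ (l - 1 + 3 * ε) * ((c₁ * Literature.NumberTheory.DiophantineGeometry.AbcShapes.shapeVal X : ℕ) : ℝ)) → (Literature.NumberTheory.DiophantineGeometry.AbcShapes.shapeCount c₁ c₂ c₃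 X Y Z : ℝ) ≤ K * (C₀ : ℝ) ^ (l - 1 + 3 * ε + η) := by
  intro l _ _ ε _ _ η hη
  obtain ⟨K, -, hK⟩ := twoRootTameX_law l ε hη (numShapes ε)
  exact ⟨K, hK⟩

end Summit.ABC.ABC.Theorems.MazurKaneLaw

end
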